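import Summits.Ventures.CertifiedManyBodySolver.Downfold.EmeryAxialConductionBand
import HarnessLib

/-!
# The axial co-shift only LOWERS the antibonding band: monotonicity of the co-shifted σ band, occupied set and
# filling in the axial admixture `a` (hence of the four-orbital conduction-band filling in `t_sp²` and `−ε_s`)

Venture CertifiedManyBodySolver, cell `pub/hubbard-downfold` (stage S1), seat hubbard-downfold-mod-4 (technique B); namespace
`Summit.Ventures.CertifiedManyBodySolver.Downfold.Emery`. Everything here is PROVED. WHAT THIS IS NOT: a statement about any
material; `U = 0` band kinematics.

`EmeryAxialConductionBand` identifies the four-orbital conduction band at energy `ε` with the σ antibonding band at the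
CO-SHIFTED O–O hoppings `(t_pp + a, t_pp′ + a)`, `a = t_sp²/(ε_s − ε)`. The co-shift is a NEGATIVE-semidefinite rank-one
perturbation of the σ Bloch matrix: `q·H(a)q = q·H(0)q − 4a(sx·q_px + sy·q_py)²` (`rayleigh_bloch4_coshift`). Hence (Rayleigh,
via `EmeryBandEigenvalues`):

* `abBand_coshift_anti` — at every `k` the co-shifted antibonding band is ANTITONE in `a`;
* `abOccSet_coshift_mono`, `abFilling_coshift_mono` — at fixed Fermi energy the occupied set and the filling GROW with `a`
  (so at fixed filling the Fermi energy can only go DOWN — the direction used by the census `EmeryAxialSlab*`);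
* `condOccSet_mono_tsp_sq`, `condFilling_mono_tsp_sq` — the four-orbital conduction-band occupied set / filling at `ε < ε_s`
  grow with the axial coupling `t_sp²` (at fixed `ε_s`), by the transfer theorem `condOccSet_eq_abOccSet`.

Together with `EmeryAxialFermiSurfaceShape.fsRatio_coshift_anti` (the FS `t′/t` is antitone in `a` at fixed energy) and
`EmeryAxialConductionBand.band4_one_le_abBand` this is the complete sign content of [PavariniEtAl2001, Fig. 3]: more axial
admixture ⇒ lower conduction band, lower Fermi energy at fixed hole count, more cuprate-like Fermi surface, larger x_VH.
Sources: [AndersenEtAl1995, §5]; [PavariniEtAl2001, Eqs. (1)–(3), Fig. 3]; [HybertsenSchluterChristensen1989, Eq. (1)].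
-/

noncomputable section

namespace Summit.Ventures.CertifiedManyBodySolver.Downfold.Emery

open Real Matrix WithLp MeasureTheory Set
open scoped InnerProductSpace

/-- THE CO-SHIFT IS A NEGATIVE RANK-ONE PERTURBATION of the σ quadratic form:
`q·H(t_pp + a, t_pp′ + a)q = q·H(t_pp, t_pp′)q − 4a(sx·q₁ + sy·q₂)²`. [cite: AndersenEtAl1995, §5] -/
theorem rayleigh_bloch4_coshift (Δ tpd tpp c a sx sy : ℝ) (q : Fin 3 → ℝ) :
    q ⬝ᵥ (bloch4 Δ tpd (tpp + a) (c + a) sx sy *ᵥ q) =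
      q ⬝ᵥ (bloch4 Δ tpd tpp c sx sy *ᵥ q) - 4 * a * (sx * q 1 + sy * q 2) ^ 2 := by
  simp [bloch4, Matrix.mulVec, dotProduct, Fin.sum_univ_three]
  ring

/-- **THE CO-SHIFTED ANTIBONDING BAND IS ANTITONE IN THE ADMIXTURE**: `a₁ ≤ a₂ ⇒ ε_AB(t_pp + a₂, t_pp′ + a₂) ≤
ε_AB(t_pp + a₁, t_pp′ + a₁)` at every `k` (top eigenvalue of a form that decreases pointwise).
[cite: PavariniEtAl2001, Fig. 3]; [cite: HornJohnson2013, Thm 4.2.6] -/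
theorem abBand_coshift_anti {a₁ a₂ : ℝ} (h : a₁ ≤ a₂) (Δ tpd tpp c sx sy : ℝ) :
    abBand Δ tpd (tpp + a₂) (c + a₂) (sx ^ 2) (sy ^ 2) ≤ abBand Δ tpd (tpp + a₁) (c + a₁) (sx ^ 2) (sy ^ 2) := by
  have hH2 := bloch4_isHermitian Δ tpd (tpp + a₂) (c + a₂) sx sy
  have hT2 : (toEuclideanLin (bloch4 Δ tpd (tpp + a₂) (c + a₂) sx sy)).IsSymmetric :=
    isSymmetric_toEuclideanLin_iff.mpr hH2
  obtain ⟨z, -, hz0, hz⟩ := Literature.Analysis.InnerProduct.exists_mem_eigenvalues_mul_le_re_inner hT2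
    finrank_euclideanSpace ⟨0, by simp⟩ ⊤ (by simp)
  rw [RCLike.re_to_real, inner_toEuclideanLin_self, norm_sq_eq_dotProduct] at hz
  change band3 Δ tpd (tpp + a₂) (c + a₂) sx sy 0 * _ ≤ _ at hz
  rw [← abBand_eq_band3_zero] at hz
  set q : Fin 3 → ℝ := ofLp z with hq
  have hqq : 0 < q ⬝ᵥ q := by
    rw [← norm_sq_eq_dotProduct]; exact pow_pos (norm_pos_iff.mpr hz0) 2
  -- the form at a₂ is below the form at a₁, which is below abBand(a₁)·‖q‖²
  have h12 : q ⬝ᵥ (bloch4 Δ tpd (tpp + a₂) (c + a₂) sx sy *ᵥ q) ≤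
      q ⬝ᵥ (bloch4 Δ tpd (tpp + a₁) (c + a₁) sx sy *ᵥ q) := by
    have e2 := rayleigh_bloch4_coshift Δ tpd tpp c a₂ sx sy q
    have e1 := rayleigh_bloch4_coshift Δ tpd tpp c a₁ sx sy q
    nlinarith [sq_nonneg (sx * q 1 + sy * q 2)]
  have h1 := rayleigh_bloch4_le_abBand Δ tpd (tpp + a₁) (c + a₁) sx sy q
  exact le_of_mul_le_mul_right (hz.trans (h12.trans h1)) hqq

/-- **At fixed Fermi energy the co-shifted occupied set GROWS with the admixture.** [cite: PavariniEtAl2001, Fig. 3] -/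
theorem abOccSet_coshift_mono {a₁ a₂ : ℝ} (h : a₁ ≤ a₂) (Δ tpd tpp c ε : ℝ) :
    abOccSet Δ tpd (tpp + a₁) (c + a₁) ε ⊆ abOccSet Δ tpd (tpp + a₂) (c + a₂) ε := by
  intro k hk
  refine ⟨hk.1, ?_⟩
  have hmono := abBand_coshift_anti h Δ tpd tpp c (Real.sin (k.1 / 2)) (Real.sin (k.2 / 2))
  have hk2 := hk.2
  simp only [halfSq] at hk2 ⊢
  exact hmono.trans hk2

/-- **… and so does the filling** (per spin): `a₁ ≤ a₂ ⇒ abFilling(t_pp + a₁, t_pp′ + a₁; ε) ≤ abFilling(t_pp + a₂,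
t_pp′ + a₂; ε)`; equivalently, at fixed filling the Fermi energy can only move DOWN with the admixture.
[cite: PavariniEtAl2001, Fig. 3] -/
theorem abFilling_coshift_mono {a₁ a₂ : ℝ} (h : a₁ ≤ a₂) (Δ tpd tpp c ε : ℝ) :
    abFilling Δ tpd (tpp + a₁) (c + a₁) ε ≤ abFilling Δ tpd (tpp + a₂) (c + a₂) ε := by
  unfold abFilling
  refine div_le_div_of_nonneg_right ?_ (by positivity)
  exact ENNReal.toReal_mono (volume_abOccSet_ne_top Δ tpd (tpp + a₂) (c + a₂) ε)
    (measure_mono (abOccSet_coshift_mono h Δ tpd tpp c ε))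

/-- The admixture `t_sp²/(ε_s − ε)` is monotone in `t_sp²` below the axial level. [folklore] -/
theorem coshift_mono_tsp_sq {εs ε tsp₁ tsp₂ : ℝ} (hε : ε < εs) (h : tsp₁ ^ 2 ≤ tsp₂ ^ 2) :
    tsp₁ ^ 2 / (εs - ε) ≤ tsp₂ ^ 2 / (εs - ε) :=
  div_le_div_of_nonneg_right h (sub_pos.mpr hε).le

/-- **The four-orbital conduction-band occupied set at `ε < ε_s` GROWS with the axial coupling `t_sp²`** (fixed `ε_s`).
[cite: PavariniEtAl2001, Fig. 3] -/
theorem condOccSet_mono_tsp_sq {Δ εs tpd tpp c ε tsp₁ tsp₂ : ℝ} (hε : ε < εs) (h : tsp₁ ^ 2 ≤ tsp₂ ^ 2) :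
    condOccSet Δ εs tpd tpp c tsp₁ ε ⊆ condOccSet Δ εs tpd tpp c tsp₂ ε := by
  rw [condOccSet_eq_abOccSet hε, condOccSet_eq_abOccSet hε]
  exact abOccSet_coshift_mono (coshift_mono_tsp_sq hε h) Δ tpd tpp c ε

/-- **… and so does the conduction-band filling.** [cite: PavariniEtAl2001, Fig. 3] -/
theorem condFilling_mono_tsp_sq {Δ εs tpd tpp c ε tsp₁ tsp₂ : ℝ} (hε : ε < εs) (h : tsp₁ ^ 2 ≤ tsp₂ ^ 2) :
    condFilling Δ εs tpd tpp c tsp₁ ε ≤ condFilling Δ εs tpd tpp c tsp₂ ε := by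
  rw [condFilling_eq_abFilling hε, condFilling_eq_abFilling hε]
  exact abFilling_coshift_mono (coshift_mono_tsp_sq hε h) Δ tpd tpp c ε

/-- **Lowering the axial level (at fixed coupling) also grows the conduction-band occupied set**: for
`ε < ε_s′ ≤ ε_s`, `condOccSet(ε_s) ⊆ condOccSet(ε_s′)` — Pavarini's «materials with lower ε_s have larger r».
[cite: PavariniEtAl2001, p. 3] -/
theorem condOccSet_anti_axialLevel {Δ εs εs' tpd tpp c tsp ε : ℝ} (hε : ε < εs') (h : εs' ≤ εs) :
    condOccSet Δ εs tpd tpp c tsp ε ⊆ condOccSet Δ εs' tpd tpp c tsp ε := by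
  have hε2 : ε < εs := lt_of_lt_of_le hε h
  rw [condOccSet_eq_abOccSet hε2, condOccSet_eq_abOccSet hε]
  refine abOccSet_coshift_mono ?_ Δ tpd tpp c ε
  exact div_le_div_of_nonneg_left (sq_nonneg _) (sub_pos.mpr hε) (by linarith)

/-- **… and the conduction-band filling.** [cite: PavariniEtAl2001, p. 3] -/
theorem condFilling_anti_axialLevel {Δ εs εs' tpd tpp c tsp ε : ℝ} (hε : ε < εs') (h : εs' ≤ εs) :
    condFilling Δ εs tpd tpp c tsp ε ≤ condFilling Δ εs' tpd tpp c tsp ε := by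
  have hε2 : ε < εs := lt_of_lt_of_le hε h
  rw [condFilling_eq_abFilling hε2, condFilling_eq_abFilling hε]
  refine abFilling_coshift_mono ?_ Δ tpd tpp c ε
  exact div_le_div_of_nonneg_left (sq_nonneg _) (sub_pos.mpr hε) (by linarith)

end Summit.Ventures.CertifiedManyBodySolver.Downfold.Emery
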